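import Mathlib
import Summits.Ventures.PercRepro2.Graph

/-!
# Connectivity through an unmarked vertex of degree two
(blind cell PercRepro2, mine-c g15, 2026-08-25; `proofs/MINEC-TB14BLOCK.md` Theorem D, the series rule)

Let `w` be a vertex whose only edges are `e₁ = w u` and `e₂ = w v`.  For vertices `x, x' ≠ w`:
* `conn_congr_open`: connectivity only sees the open edges and their ends;
* `not_conn_isolated`: no connection reaches a vertex with no open edge;
* `conn_leaf_erase`: if `e₁` is the only open edge at `w`, closing it changes no connection off `w`;
* `conn_series`: if `e₁, e₂` are both open, rerouting `e₁` to `u v` and closing `e₂` changes no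
  connection off `w` — the open path `u – w – v` is the open edge `u v`.
Own work; standard axioms.
-/

namespace Summit.Ventures.PercRepro2

namespace TB14Cut

section Conn

variable {V : Type*} {E : Type*} [DecidableEq E]

omit [DecidableEq E] in
/-- Connectivity only depends on the open edges and their ends. -/
lemma conn_congr_open {ends ends' : E → Sym2 V} {y y' : Config E}
    (h : ∀ f, y f = true → y' f = true ∧ ends' f = ends f)
    (h' : ∀ f, y' f = true → y f = true ∧ ends f = ends' f) (x x' : V) :
    Conn ends y x x' ↔ Conn ends' y' x x' := by
  have hg : openGraph ends y = openGraph ends' y' := by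
    ext a b
    rw [openGraph_adj, openGraph_adj]
    constructor
    · rintro ⟨hab, f, hf, hends⟩
      exact ⟨hab, f, (h f hf).1, by rw [(h f hf).2, hends]⟩
    · rintro ⟨hab, f, hf, hends⟩
      exact ⟨hab, f, (h' f hf).1, by rw [(h' f hf).2, hends]⟩
  unfold Conn
  rw [hg]

omit [DecidableEq E] in
/-- A vertex with no open edge is reached by nothing else. -/
lemma not_conn_isolated {ends : E → Sym2 V} {y : Config E} {w : V}
    (hiso : ∀ f, w ∈ ends f → y f = false) {x : V} (hx : x ≠ w) : ¬ Conn ends y x w := by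
  intro hc
  have key : w ∈ {t | t ≠ w} := by
    refine mem_of_conn_of_closed (S := {t | t ≠ w}) ?_ hx hc
    intro t _ t' htt'
    obtain ⟨_, f, hf, hends⟩ := openGraph_adj.1 htt'
    intro ht'
    subst ht'
    have : t' ∈ ends f := by rw [hends]; exact Sym2.mem_mk_right _ _
    rw [hiso f this] at hf
    exact Bool.false_ne_true hf
  exact key rfl

/-- **The leaf rule**: if `e₁ = w u` is the only open edge at `w`, closing it does not change any
connection between vertices other than `w`. -/
lemma conn_leaf_erase {ends : E → Sym2 V} {y : Config E} {e₁ : E} {w u : V}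
    (h₁ : ends e₁ = s(w, u)) (hwu : w ≠ u) (hw : ∀ f, w ∈ ends f → f ≠ e₁ → y f = false)
    (hy : y e₁ = true) {x x' : V} (hx : x ≠ w) (hx' : x' ≠ w) :
    Conn ends y x x' ↔ Conn ends (Function.update y e₁ false) x x' := by
  set y' := Function.update y e₁ false with hy'
  have hle : y' ≤ y := by
    intro f
    by_cases hf : f = e₁
    · subst hf; simp [hy']
    · simp [hy', Function.update_of_ne hf]
  constructor
  · intro hc
    have hiso' : ∀ f, w ∈ ends f → y' f = false := by
      intro f hf
      by_cases hfe : f = e₁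
      · subst hfe; simp [hy']
      · rw [hy', Function.update_of_ne hfe]; exact hw f hf hfe
    have key : x' ∈ {t | Conn ends y' x t ∨ (t = w ∧ Conn ends y' x u)} := by
      refine mem_of_conn_of_closed (S := {t | Conn ends y' x t ∨ (t = w ∧ Conn ends y' x u)}) ?_
        (Or.inl (conn_refl _ _ _)) hc
      intro t ht t' htt'
      obtain ⟨_, f, hf, hends⟩ := openGraph_adj.1 htt'
      by_cases hfe : f = e₁
      · subst hfe
        rw [h₁, Sym2.eq_iff] at hends
        rcases hends with ⟨rfl, rfl⟩ | ⟨rfl, rfl⟩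
        · -- `t = w`, `t' = u`
          rcases ht with ht | ⟨_, ht⟩
          · exact absurd ht (not_conn_isolated hiso' hx)
          · exact Or.inl ht
        · -- `t = u`, `t' = w`
          rcases ht with ht | ⟨ht, _⟩
          · exact Or.inr ⟨rfl, ht⟩
          · exact absurd ht hwu.symm
      · have hwf : w ∉ ends f := fun hwf => by
          have := hw f hwf hfe
          rw [this] at hf
          exact Bool.false_ne_true hf
        have ht_ne : t ≠ w := fun h => hwf (by rw [hends, h]; exact Sym2.mem_mk_left _ _)
        have ht'_ne : t' ≠ w := fun h => hwf (by rw [hends, h]; exact Sym2.mem_mk_right _ _)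
        rcases ht with ht | ⟨ht, _⟩
        · refine Or.inl (conn_trans ht (conn_of_openAdj ⟨f, ?_, hends⟩))
          rw [hy', Function.update_of_ne hfe]
          exact hf
        · exact absurd ht ht_ne
    rcases key with hk | ⟨hk, _⟩
    · exact hk
    · exact absurd hk hx'
  · exact conn_mono hle

/-- **The series rule for connections**: if `e₁ = w u` and `e₂ = w v` are the only edges at `w`
and both are open, then rerouting `e₁` to `u v` and closing `e₂` does not change any connection
between vertices other than `w`. -/
lemma conn_series {ends : E → Sym2 V} {y : Config E} {e₁ e₂ : E} {w u v : V} (he : e₁ ≠ e₂)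
    (h₁ : ends e₁ = s(w, u)) (h₂ : ends e₂ = s(w, v)) (hwu : w ≠ u) (hwv : w ≠ v)
    (hw : ∀ f, w ∈ ends f → f = e₁ ∨ f = e₂) (hy₁ : y e₁ = true) (hy₂ : y e₂ = true)
    {x x' : V} (hx : x ≠ w) (hx' : x' ≠ w) :
    Conn ends y x x' ↔
      Conn (Function.update ends e₁ s(u, v)) (Function.update y e₂ false) x x' := by
  set ends' := Function.update ends e₁ s(u, v) with hends'
  set y₁ := Function.update y e₂ false with hy₁'
  have hy₁e₁ : y₁ e₁ = true := by rw [hy₁', Function.update_of_ne he]; exact hy₁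
  have hends'e₁ : ends' e₁ = s(u, v) := by simp [hends']
  have huv : Conn ends' y₁ u v := conn_of_openAdj ⟨e₁, hy₁e₁, hends'e₁⟩
  have hiso' : ∀ f, w ∈ ends' f → y₁ f = false := by
    intro f hf
    by_cases hfe₂ : f = e₂
    · subst hfe₂; simp [hy₁']
    by_cases hfe₁ : f = e₁
    · subst hfe₁
      rw [hends'e₁] at hf
      rcases Sym2.mem_iff.1 hf with h | h
      · exact absurd h hwu
      · exact absurd h hwv
    · rw [hends', Function.update_of_ne hfe₁] at hf
      rcases hw f hf with h | h
      · exact absurd h hfe₁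
      · exact absurd h hfe₂
  constructor
  · intro hc
    have key : x' ∈ {t | Conn ends' y₁ x t ∨ (t = w ∧ Conn ends' y₁ x u)} := by
      refine mem_of_conn_of_closed (S := {t | Conn ends' y₁ x t ∨ (t = w ∧ Conn ends' y₁ x u)})
        ?_ (Or.inl (conn_refl _ _ _)) hc
      intro t ht t' htt'
      obtain ⟨_, f, hf, hends⟩ := openGraph_adj.1 htt'
      by_cases hfe₁ : f = e₁
      · subst hfe₁
        rw [h₁, Sym2.eq_iff] at hends
        rcases hends with ⟨rfl, rfl⟩ | ⟨rfl, rfl⟩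
        · rcases ht with ht | ⟨_, ht⟩
          · exact absurd ht (not_conn_isolated hiso' hx)
          · exact Or.inl ht
        · rcases ht with ht | ⟨ht, _⟩
          · exact Or.inr ⟨rfl, ht⟩
          · exact absurd ht hwu.symm
      by_cases hfe₂ : f = e₂
      · subst hfe₂
        rw [h₂, Sym2.eq_iff] at hends
        rcases hends with ⟨rfl, rfl⟩ | ⟨rfl, rfl⟩
        · rcases ht with ht | ⟨_, ht⟩
          · exact absurd ht (not_conn_isolated hiso' hx)
          · exact Or.inl (conn_trans ht huv)
        · rcases ht with ht | ⟨ht, _⟩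
          · exact Or.inr ⟨rfl, conn_trans ht (conn_symm huv)⟩
          · exact absurd ht hwv.symm
      · have hwf : w ∉ ends f := fun hwf => by
          rcases hw f hwf with h | h
          · exact hfe₁ h
          · exact hfe₂ h
        have ht_ne : t ≠ w := fun h => hwf (by rw [hends, h]; exact Sym2.mem_mk_left _ _)
        rcases ht with ht | ⟨ht, _⟩
        · refine Or.inl (conn_trans ht (conn_of_openAdj ⟨f, ?_, ?_⟩))
          · rw [hy₁', Function.update_of_ne hfe₂]; exact hf
          · rw [hends', Function.update_of_ne hfe₁]; exact hends
        · exact absurd ht ht_ne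
    rcases key with hk | ⟨hk, _⟩
    · exact hk
    · exact absurd hk hx'
  · intro hc
    have hw_uv : Conn ends y u v :=
      conn_trans (conn_symm (conn_of_openAdj ⟨e₁, hy₁, h₁⟩)) (conn_of_openAdj ⟨e₂, hy₂, h₂⟩)
    refine mem_of_conn_of_closed (S := {t | Conn ends y x t}) ?_ (conn_refl _ _ _) hc
    intro t ht t' htt'
    obtain ⟨_, f, hf, hends⟩ := openGraph_adj.1 htt'
    by_cases hfe₁ : f = e₁
    · subst hfe₁
      rw [hends'e₁, Sym2.eq_iff] at hends
      rcases hends with ⟨rfl, rfl⟩ | ⟨rfl, rfl⟩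
      · exact conn_trans ht hw_uv
      · exact conn_trans ht (conn_symm hw_uv)
    by_cases hfe₂ : f = e₂
    · subst hfe₂
      rw [hy₁'] at hf
      simp at hf
    · refine conn_trans ht (conn_of_openAdj ⟨f, ?_, ?_⟩)
      · rw [hy₁', Function.update_of_ne hfe₂] at hf; exact hf
      · rw [hends', Function.update_of_ne hfe₁] at hends; exact hends

end Conn

end TB14Cut

end Summit.Ventures.PercRepro2
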